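import Mathlib
import HarnessLib
import HarnessLib.Audit
import Summits.FinalStateConjecture.Statement
import HarnessLib.Audit.Status.Attr

/-!
Route: ResolvedTimelikeInfinity

# Route ResolvedTimelikeInfinity — orbital multi-Kerr proximity outside a compact set upgrades to
settling down, via i⁺ blown up into N Kerr faces

X = A ∧ B ("it suffices to show"), realising card resolve-timelike-infinity-kerr-faces. The seam is
ORBIT(𝒟; N, Mᵢ, aᵢ, (Λᵢ,cᵢ); q, k, δ):
outside a compact spacetime region the maximal development 𝒟 is δ-close in Cᵏ to an N-Kerr model
geometry — unweighted on the near-zone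
Kerr–Schild slabs {t*ᵢ = τ, rᵢ ≤ Rᵢ(τ)} of N boosted sub-extremal Kerr charts, and at weight
(1+|x̲|)^q (1+|x⁰−|x̲||)^m on the m-th
derivative of Ψ₀^*g − η at every late point and every far point of ONE asymptotically Cartesian
chart Ψ₀ whose domain contains the late
half-space minus sublinear tubes AND the far region {ϱ₀+|x⁰| < |x̲|} and which charts the end of the
initial slice — with the charts causally
exhausting J⁺(ιX) ∩ I⁻(charts) at every later chart time. A = ORBIT FORMATION (imported pre-phase):
Christodoulou-generic admissible data have an MGHD, and every MGHD orbits some configuration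
with pairwise distinct final 4-velocities to every accuracy (∀ q<1, k, δ>0). B = RESOLVED-i⁺ CAPTURE
(the card): for each configuration there
is δ>0 such that an admissible MGHD which orbits it at accuracy δ has complete 𝓘⁺ and settles down
in the sense of the Statement (C²
final-state decomposition with sub-extremal holes on O = J⁺(ιX) ∩ I⁻(charts), charts exhausting O) —
to be proved by realising g as a
polyhomogeneous section on the compactification with i⁺ blown up to H³ and blown up again at the N
velocity points (Kerr faces).
Lean: `OrbitFormation ∧ ResolvedCapture`

## Assembly
Pure logic, sorry-free in Sketch.lean and in the deciding theorem `closes`: fix X; OrbitFormation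
gives genericity of P_A(D) = (MGHD exists) ∧
(every MGHD orbits some configuration to every accuracy); ResolvedCapture gives, for that
configuration, q, k, δ and the implication ORBIT(q,k,δ) ⇒
(complete 𝓘⁺ ∧ FSC(ii)-conclusion); hence P_A(D) → P_FSC(D) for every admissible D, and GenericMono
(inlined in `closes`) transports genericity.
SingleKerrOrbitalCapture is the informative N = 1 rung and is not used by `closes`.

Rationale: WHY THIS LINE. Clause (ii) of the conjecture is an ASYMPTOTICS statement, and geometric microlocal
analysis turns "asymptotics in several regimes with matching"
into regularity on a compact manifold with corners: Hintz–Vasy prove Minkowski stability with i⁺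
blown up and polyhomogeneous index sets with
logs (HintzVasy2017 = arXiv:1711.00195), Hintz controls the far exterior of ANY asymptotically flat
datum in the same calculus (arXiv:2302.14613,
the b-version of KlainermanNicolo2003), the Kerr face has its linear model theory (arXiv:1906.00860,
arXiv:1903.03859; full |a|<M mode analysis
arXiv:2302.08916; Price-law asymptotics Hintz2021), Hintz's Λ>0 many-black-hole gluing realises "N
holes = N marked boundary points"
(arXiv:2001.10401) and his small-black-hole gluing I–III handles a two-scale corner of exactly this
type (arXiv:2306.07409, arXiv:2408.06715),
while Vasy's many-body scattering calculus (arXiv:math/9906161) supplies the geometry of the new Λ=0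
corner ι⁺ ∩ Kᵢ (imported from N-body
quantum scattering: collision planes ↦ Kerr points, cluster Hamiltonians ↦ face normal operators).
The route cuts the conjecture at the
dynamical-systems seam ORBITAL ⇒ ASYMPTOTIC: A delivers global-in-time closeness (what every
physical heuristic gives), B upgrades closeness to
convergence, rates, exhaustive charts and complete 𝓘⁺ — the part this calculus is built for — so no
crux is an averaged or analogue statement
and the deciding theorem is pure logic (monotonicity of Christodoulou genericity). No prior route
exists on this summit; negatives index empty.

RANKED CRUXES. #2 ResolvedCapture (crux) — (card K2+K3, the capture engine) there are a weight 0<q<1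
and an order k such that for every configuration of N sub-extremal Kerr parameters with pairwise
distinct boosted 4-velocities there is δ>0 with: every maximal vacuum Cauchy development of
admissible data that ORBITS the configuration at accuracy (q,k,δ) has complete future null infinity
(sojourn form) and admits a C² final-state decomposition with sub-extremal holes on O = J⁺(ιX) ∩
I⁻(charted) whose charts exhaust O. [difficulty: open-problem] (why it might fail: No nonlinear Kerr
stability is closed in b-form for any a; |a|→M needs SR-TdC in Fredholm form; the Λ=0 corner ι⁺∩Kᵢ
with (M/v²)log t drift and ADM/Bondi balance constraints has no parametrix yet; hypothesis is
sup-norm Cᵏ with q<1 only.) [HintzVasy2017, arXiv:2302.14613, arXiv:1906.00860, arXiv:1903.03859,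
arXiv:2302.08916, arXiv:2306.07409, arXiv:2408.06715, arXiv:math/9906161, arXiv:2001.10401,
Hintz2021]
#3 OrbitFormation (crux) — (imported pre-phase, card item (4)) for Christodoulou-generic admissible
data an MGHD exists and every MGHD ORBITS some configuration (N, Mᵢ>|aᵢ|, motions (Λᵢ,cᵢ) with
pairwise distinct Λᵢe₀) to every accuracy: for all 0<q<1, k, δ>0 there are a late time, sublinear
tubes, near-zone radii, N boosted Kerr–Schild late charts, one flat chart on late-minus-tubes ∪ far
region charting the end of ιX, δ-closeness as in the seam, and causal exhaustion at every later
chart time. [difficulty: open-problem] (why it might fail: It is most of the physics: collapse,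
mergers, weak cosmic censorship, no eternal bound or parabolic (equal final velocity) pairs except
non-generically, far-exterior control for DR-rate data, and k≥3 tails at i⁰ that only
curve-genericity can move off.) [Christodoulou1999, DafermosRodnianski2013, KlainermanNicolo2003,
Shen2022, arXiv:2302.14613, Klainerman2025, arXiv:1710.01722, Christodoulou2008, arXiv:2601.01517]
#4 SingleKerrOrbitalCapture (crux) — (the Kerr-face rung in the prelude's own vocabulary) there is k
such that for every sub-extremal (M,a) there is ε>0 with: if a maximal vacuum development of
admissible data REMAINS ε-CLOSE in Cᵏ to Kerr(M,a) on a region O ⊆ J⁺(ιX)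
(Spacetime.RemainsCloseToKerr: late Kerr–Schild embedding covering O, deviation ≤ ε on every slab t*
= τ ≥ τ₀), then it CONVERGES on O in C² to a nearby sub-extremal Kerr (Spacetime.ConvergesToKerr) —
orbital ⇒ asymptotic stability of the Kerr exterior. [difficulty: open-problem] (why it might fail:
Unweighted Cᵏ ε-closeness on slabs reaching i⁰ does not give the weighted smallness KS/GKS/DHRT
start from; slowly incoming radiation and parameter drift must die by admissibility alone; constants
degenerate as |a|→M and nothing nonlinear is known beyond |a|≪M.) [KlainermanSzeftel2023,
arXiv:2205.14808, DafermosHolzegelRodnianskiTaylor2021, DafermosRodnianskiShlapentokhrothman2014,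
arXiv:2302.08916, AngelopoulosAretakisGajic2018, arXiv:1906.00860]
#9 GenericMono (support) — Christodoulou genericity (codimension ≥ 1 inside the admissible class) is
monotone in the property: if P → Q on admissible data then generic P implies generic Q. Proved in
the planner's Sketch.lean (evidence attached); it is the only logic the deciding theorem uses.
[difficulty: provable-now] [Christodoulou1999]

TWO-LAYER PLAN. ResolvedCapture ⇐ FaceRungs → CornerParametrix → ResolvedCapture (k = 2 children +
glue): FaceRungs = the N = 0 (Minkowski face, HintzVasy2017
technology in orbital form) and N = 1 (Kerr face = SingleKerrOrbitalCapture restated over ORBIT)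
cases; CornerParametrix = uniform boundedness and
integrated decay for linear waves on the N-centre boosted Kerr–Schild superposition η +
Σᵢ(g_{Mᵢ,aᵢ,Λᵢ,cᵢ} − η) at late times (the linear toy of
ι⁺ ∩ Kᵢ; needs definition request D2). OrbitFormation ⇐ FarExteriorControl (all admissible data;
Shen2022 = arXiv:2211.15230 and arXiv:2302.14613, after KlainermanNicolo2003,
for the DR-rate class) → LateOrbit (generic) → OrbitFormation, glued by a chart-patching statement.
Nothing here is filed now.

KILL CRITERIA. An admissible MGHD that orbits a configuration at every accuracy but does not settle
(a vacuum "breather" exterior, or perpetual parameter drift),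
or a proof that the Λ=0 corner model operator for two comparable masses has a non-gauge,
non-modulation kernel obstructing polyhomogeneity,
refutes ResolvedCapture — close `refuted:ResolvedCapture` (the card dies with it).
¬SingleKerrOrbitalCapture for one sub-extremal (M,a) kills
the Kerr face and therefore the line — close. ¬OrbitFormation alone (generic
parabolic/equal-velocity final motions, non-removable i⁰ tails,
far-exterior failure for DR rates) forces a PIVOT of the seam (`--restate` ORBIT: weaker weights,
velocity multiplicities, k ≤ 2), not a close.
FSC(ii)+(i) proved by a physical-space route moots this one (supersede).

NOT DECOMPOSED YET. The face rungs and the corner parametrix (children of ResolvedCapture);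
modulation of (Mᵢ, aᵢ, Λᵢ) and the Coulomb-log-modified blow-up;
the ADM-to-Bondi balance laws the compactification must encode (Λ=0 shadow of Hintz's balance
conditions); the values of q and k; the split of
OrbitFormation into far-exterior control (all data) and late orbit (generic); an ORBIT-form
restatement of SingleKerrOrbitalCapture. All are
layer-2 children for tenure, after a crux moves.

CHEAPEST FALSIFIER. Literature lookup + one model check. (a) Is "orbital ⇒ asymptotic stability" for
the Kerr exterior, or a Λ=0 multi-Kerr compactification of i⁺,
already in print or known false? (frontier/bridges runs found neither; Alexakis–Schlue's
non-existence of time-periodic AF vacuum exteriors and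
Ionescu–Klainerman rigidity cover only the periodic corner of a would-be counterexample.) (b)
Refuter sanity check of the seam on the one available
model: Minkowski space as MGHD of trivial data with Ψ₀ = id must satisfy ORBIT with N = 0 for every
(q,k,δ) (deviation ≡ 0; exhaustion clause by
flat causality) — if the clause structure forbids even that, ORBIT is misstated and both cruxes must
be restated.

NUMBERS. Price-law tails t⁻³ on sub-extremal Kerr (Hintz2021; AngelopoulosAretakisGajic2018) — the
output is C² convergence without rate, consistent.
Nonlinear Kerr stability known for |a|/M ≪ 1 only (KlainermanSzeftel2023, arXiv:2205.14808); linear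
Teukolsky control on the full range |a|<M
(arXiv:2302.08916). Comparable-mass hyperbolic encounters: worldline drift (M/v²) log t behind the
straight asymptote; flat-zone tolerance
δ(1+r)^{-q}(1+|u|)^{-m} forces excision tubes of radius ~ t^{(q+k)/(1+k)} < t (sublinear, as the
Statement's decomposition allows). Items at open: 5.

DEFINITION REQUESTS. D1 `OrbitsMultiKerr` (topic
Summits/FinalStateConjecture/FinalStateConjecture/Theorems): the seam ORBIT(𝒟; N, M, a, mot; q, k,
δ) as a named
predicate, verbatim the inlined ∃-block shared by ResolvedCapture and OrbitFormation, so that tenure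
can restate both cruxes over it and file the
face rungs. D2 `multiCentreKerrSchildBilin` (topic Literature/Geometry/Lorentzian): x ↦ η + Σᵢ
(boostedKerrBilin Λᵢ cᵢ Mᵢ aᵢ x − η), the N-centre
boosted Kerr–Schild superposition on E4, with its late-time Lorentzian domain, for the corner toy
(CornerParametrix). No cite facts are requested:
every named result enters proofs, not statements.

Novelty: Searches (2026-08-15): `lit frontier FinalStateConjecture --since 2021` (30 rows; pertinent:
arXiv:2601.01517 multi-black-hole Cauchy data with
prescribed ADM parameters, arXiv:2112.07183 nonlinear KdS stability, arXiv:2212.14093 quasilinear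
waves on AF/Kerr backgrounds — none compactifies
i⁺ with Kerr points); `lit bridges FinalStateConjecture --cross any` (30 rows, surveys; no
microlocal bridge); `lit search --hybrid "Hintz Vasy
stability Minkowski polyhomogeneous …"` and `lit galaxy search "stability of Minkowski space
polyhomogeneity compactification timelike infinity
black holes" --star all` (0 rows, queue timeouts; a later `lit galaxy search "polyhomogeneity of the
metric" --star pdf` gave 2 rows: Shen2022 exterior
stability, Ionescu–Pausader EKG book) both returned service-unavailable / 0 rows at filing (rc 75,
galaxyd queue); `lit search --source arxiv "multi black hole timelike
infinity compactification Einstein vacuum late-time asymptotics"` (0 rows) and `… "orbital stability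
asymptotic stability Kerr black hole exterior
vacuum Einstein"` (0 rows); `lit search --source zbmath "Vasy many-body scattering propagation of
singularities resolution"` (1 row, Kottke–Rochon
fibered corners arXiv:2206.07262 — the manifold-with-corners bookkeeping this line would use, no
GR); OpenAlex budget exhausted (429) — to be re-run
by the novelty audit; the card carries three refuter audits (zbMATH 'Vasy many-body scattering',
'Hintz gluing small black holes'; arXiv probes; lit frontier  [refs: 2601.01517, 2112.07183, 2212.14093, 2206.07262, 2001.10401, 1711.00195, 2302.14613, 2306.07409, 2408.06715, math/9906161, Shen2022, HintzVasy2017, KlainermanSzeftel2023]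

Barriers (technique_class: geometric-microlocal, b-calculus, many-body-blow-up): - technique_class: geometric-microlocal, b-calculus, many-body-blow-up
- Literature.Barriers.FinalStateConjecture.KehrbergerLogarithmicAsymptotics: evaded by design — no
Penrose-smooth 𝓘⁺, no peeling: index sets carry log terms exactly as in HintzVasy2017, completeness
of 𝓘⁺ is the intrinsic sojourn notion, and the seam measures weighted Cᵏ sup norms, not conformal
regularity.
- Literature.Barriers.FinalStateConjecture.PriceLawTail: consistent — the output is the Statement's
rate-free C² convergence; internally only inverse-polynomial (t⁻³-type) expansions at ι⁺ are
produced, never exponential or super-polynomial rates.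
- Literature.Barriers.FinalStateConjecture.SlowlyRotatingKerrFrontier: it does not evade it; the bet
is that the Kerr-face model theory for all |a|<M can be assembled from SR-TdC mode analysis
(arXiv:2302.08916) plus HHV-type Fredholm estimates — SingleKerrOrbitalCapture is filed precisely to
expose this.
- Literature.Barriers.FinalStateConjecture.SbierskiTrappingObstruction: known evasion — per-face
high-frequency estimates at normally hyperbolic trapping lose derivatives, which the seam absorbs by
letting ResolvedCapture choose k.
- Literature.Barriers.FinalStateConjecture.KerrSuperradiance: no Killing-energy positivity is used;
superradiant frequencies are handled by mode stability and the Fredholm set-up per face (small a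
known, full range imported from SR-TdC).
- Literature.Barriers.FinalStateConjecture.AretakisInstability: faces are strictly sub-extremal

sub-problem: FinalStateConjecture · status: open · opened planner-plancard-FinalStateConjecture-FinalSt-11146942-0 2026-08-15T15:12:36Z · rev 0 · ledger route-FinalStateConjecture-ResolvedTimelikeInfinity
GENERATED by the gate from the ledger (D-0016/17). Provers cite these decls: `theorem foo : Summit.FinalStateConjecture.FinalStateConjecture.Theses.ResolvedTimelikeInfinity.<Decl> := …` in Summits/FinalStateConjecture/FinalStateConjecture/Theorems/<Name>.lean.
-/

namespace Summit.FinalStateConjecture.FinalStateConjecture.Theses.ResolvedTimelikeInfinity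

open scoped BigOperators Topology Manifold Classical MeasureTheory ProbabilityTheory Matrix InnerProductSpace ComplexConjugate ContinuousMap
open Filter Set Function TopologicalSpace MeasureTheory

attribute [summit_statement] _root_.FinalStateConjecture

/-- item stmt-FinalStateConjecture-10125 · crux · rank 2 · open · by planner
why it might fail: No nonlinear Kerr stability is closed in b-form for any a; |a|→M needs SR-TdC in Fredholm form; the Λ=0 corner ι⁺∩Kᵢ with (M/v²)log t drift and ADM/Bondi balance constraints has no parametrix yet; hypothesis is sup-norm Cᵏ with q<1 only.
sources: HintzVasy2017, arXiv:2302.14613, arXiv:1906.00860, arXiv:1903.03859, arXiv:2302.08916, arXiv:2306.07409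
[crux] (card K2+K3, the capture engine) there are a weight 0<q<1 and an order k such that for every
configuration of N sub-extremal Kerr parameters with pairwise distinct boosted 4-velocities there is
δ>0 with: every maximal vacuum Cauchy development of admissible data that ORBITS the configuration
at accuracy (q,k,δ) has complete future null infinity (sojourn form) and admits a C² final-state
decomposition with sub-extremal holes on O = J⁺(ιX) ∩ I⁻(charted) whose charts exhaust O.
[difficulty: open-problem] -/
@[route_item "route-FinalStateConjecture-ResolvedTimelikeInfinity", crux]
def ResolvedCapture : Prop :=
  ∃ (q : ℝ) (k : ℕ), 0 < q ∧ q < 1 ∧ ∀ (N : ℕ) (M a : Fin N → ℝ) (mot : Fin N → ↥Literature.Geometry.Lorentzian.lorentzGroup × Literature.Geometry.Lorentzian.E4), (∀ i, Literature.Geometry.Lorentzian.Kerr.IsSubextremal (M i) (a i)) → (∀ i j, i ≠ j → (mot i).1.1 (EuclideanSpace.single 0 1) ≠ (mot j).1.1 (EuclideanSpace.single 0 1)) → ∃ δ : ℝ, 0 < δ ∧ ∀ (X : Type) [TopologicalSpace X] [ChartedSpace Literature.Geometry.Lorentzian.E3 X] [IsManifold (modelWithCornersSelf ℝ Literature.Geometry.Lorentzian.E3)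 ((⊤ : ℕ∞) : WithTop ℕ∞) X] [T2Space X] [SecondCountableTopology X] [ConnectedSpace X] (D : Literature.Geometry.Lorentzian.InitialDataSet (modelWithCornersSelf ℝ Literature.Geometry.Lorentzian.E3) X), D ∈ Literature.Geometry.Lorentzian.admissibleVacuumData X → ∀ 𝒟 : Literature.Geometry.Lorentzian.VacuumCauchyDevelopment D, 𝒟.IsMaximal → (∃ (τ₀ ϱ₀ : ℝ) (ρ R : Fin N → ℝ → ℝ) (U : TopologicalSpace.Opens Literature.Geometry.Lorentzian.E4) (Ψ : (i : Fin N) → ↥(Literature.Geometry.Lorentzian.boostedKerrExterior (mot i).1 (mot i).2 (M i) (a i)) → 𝒟.carrier) (Ψ₀ : ↥U → 𝒟.carrier) (B : Set X), (∀ i, 𝒟.toSpacetime.IsLateChart (Literature.Geometry.Lorentzian.boostedKerrBackground (mot i).1 (mot i).2 (M i) (a i)) Set.univ τ₀ (Ψ i)) ∧ ContMDiff (modelWithCornersSelf ℝ Literature.Geometry.Lorentzian.E4) (modelWithCornersSelf ℝ (EuclideanSpace ℝ (Fin 4))) ((⊤ : ℕ∞) : WithTop ℕ∞) Ψ₀ ∧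 Topology.IsOpenEmbedding Ψ₀ ∧ (∀ i, Filter.Tendsto (fun t : ℝ => ρ i t / t) Filter.atTop (nhds 0)) ∧ {x : Literature.Geometry.Lorentzian.E4 | (τ₀ < x 0 ∧ ∀ i, ρ i (x 0) < Literature.Geometry.Lorentzian.Kerr.radius (a i) (Literature.Geometry.Lorentzian.poincareInv (mot i).1 (mot i).2 x)) ∨ (-1 < x 0 ∧ ϱ₀ + |x 0| < Literature.Geometry.Lorentzian.E4.spatialNorm x)} ⊆ (U : Set Literature.Geometry.Lorentzian.E4) ∧ IsCompact B ∧ 𝒟.embed '' Bᶜ ⊆ Ψ₀ '' {x : ↥U | (-1 < x.1 0 ∧ ϱ₀ + |x.1 0| < Literature.Geometry.Lorentzian.E4.spatialNorm x.1)} ∧ (∀ i (τ : ℝ), τ₀ ≤ τ → 𝒟.toSpacetime.truncDeviationCk (Literature.Geometry.Lorentzian.boostedKerrBackground (mot i).1 (mot i).2 (M i) (a i)) (Ψ i) k (R i τ) τ ≤ ENNReal.ofReal δ) ∧ (∀ x : ↥U, (τ₀ < x.1 0 ∨ (-1 < x.1 0 ∧ ϱ₀ + |x.1 0| < Literature.Geometry.Lorentzian.E4.spatialNorm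 x.1)) → ∀ m : ℕ, m ≤ k → (1 + Literature.Geometry.Lorentzian.E4.spatialNorm x.1) ^ q * (1 + |x.1 0 - Literature.Geometry.Lorentzian.E4.spatialNorm x.1|) ^ m * ‖iteratedFDeriv ℝ m (𝒟.toSpacetime.deviationExtend (Literature.Geometry.Lorentzian.Minkowski.backgroundOn U) Ψ₀) x.1‖ ≤ δ) ∧ (∀ τ₁ : ℝ, τ₀ < τ₁ → exteriorOf 𝒟.toCauchyDevelopment (Ψ₀ '' (Literature.Geometry.Lorentzian.Minkowski.backgroundOn U).lateRegion τ₀ ∪ ⋃ i, Ψ i '' (Literature.Geometry.Lorentzian.boostedKerrBackground (mot i).1 (mot i).2 (M i) (a i)).lateRegion τ₀) \ (Ψ₀ '' (Literature.Geometry.Lorentzian.Minkowski.backgroundOn U).lateRegion τ₁ ∪ ⋃ i, Ψ i '' {x | τ₁ < (Literature.Geometry.Lorentzian.boostedKerrBackground (mot i).1 (mot i).2 (M i) (a i)).time x.1 ∧ (Literature.Geometry.Lorentzian.boostedKerrBackground (mot i).1 (mot i).2 (M i) (a i)).radius x.1 ≤ R i ((Literature.Geometry.Lorentzian.boostedKerrBackground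 (mot i).1 (mot i).2 (M i) (a i)).time x.1)}) ⊆ 𝒟.metric.causalPast 𝒟.timeOrientation (Ψ₀ '' (Literature.Geometry.Lorentzian.Minkowski.backgroundOn U).timeSlab τ₁ ∪ ⋃ i, Ψ i '' (Literature.Geometry.Lorentzian.boostedKerrBackground (mot i).1 (mot i).2 (M i) (a i)).truncTimeSlab (R i τ₁) τ₁))) → (HasCompleteNullInfinity 𝒟.toCauchyDevelopment ∧ ∃ (O : Set 𝒟.carrier) (d : Literature.Geometry.Lorentzian.FinalStateDecomposition 𝒟.toSpacetime O 2), (∀ i, Literature.Geometry.Lorentzian.Kerr.IsSubextremal (d.mass i) (d.spin i)) ∧ O = exteriorOf 𝒟.toCauchyDevelopment d.charted ∧ HasExhaustiveCharts d)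

/-- item stmt-FinalStateConjecture-10126 · crux · rank 3 · open · by planner
why it might fail: It is most of the physics: collapse, mergers, weak cosmic censorship, no eternal bound or parabolic (equal final velocity) pairs except non-generically, far-exterior control for DR-rate data, and k≥3 tails at i⁰ that only curve-genericity can move off.
sources: Christodoulou1999, DafermosRodnianski2013, KlainermanNicolo2003, Shen2022, arXiv:2302.14613, Klainerman2025
[crux] (imported pre-phase, card item (4)) for Christodoulou-generic admissible data an MGHD exists
and every MGHD ORBITS some configuration (N, Mᵢ>|aᵢ|, motions (Λᵢ,cᵢ) with pairwise distinct Λᵢe₀)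
to every accuracy: for all 0<q<1, k, δ>0 there are a late time, sublinear tubes, near-zone radii, N
boosted Kerr–Schild late charts, one flat chart on late-minus-tubes ∪ far region charting the end of
ιX, δ-closeness as in the seam, and causal exhaustion at every later chart time. [difficulty:
open-problem] -/
@[route_item "route-FinalStateConjecture-ResolvedTimelikeInfinity", crux]
def OrbitFormation : Prop :=
  ∀ (X : Type) [TopologicalSpace X] [ChartedSpace Literature.Geometry.Lorentzian.E3 X] [IsManifold (modelWithCornersSelf ℝ Literature.Geometry.Lorentzian.E3) ((⊤ : ℕ∞) : WithTop ℕ∞) X] [T2Space X] [SecondCountableTopology X] [ConnectedSpace X], Literature.Geometry.Lorentzian.InitialDataSet.IsChristodoulouGeneric (Literature.Geometry.Lorentzian.admissibleVacuumData X) (fun D => (∃ 𝒟 : Literature.Geometry.Lorentzian.VacuumCauchyDevelopment D, 𝒟.IsMaximal) ∧ ∀ 𝒟 : Literature.Geometry.Lorentzian.VacuumCauchyDevelopment D, 𝒟.IsMaximal → ∃ (N : ℕ) (M a : Fin N → ℝ) (mot : Fin N → ↥Literature.Geometry.Lorentzian.lorentzGroup × Literature.Geometry.Lorentzian.E4), (∀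 i, Literature.Geometry.Lorentzian.Kerr.IsSubextremal (M i) (a i)) ∧ (∀ i j, i ≠ j → (mot i).1.1 (EuclideanSpace.single 0 1) ≠ (mot j).1.1 (EuclideanSpace.single 0 1)) ∧ ∀ (q : ℝ) (k : ℕ) (δ : ℝ), 0 < q → q < 1 → 0 < δ → (∃ (τ₀ ϱ₀ : ℝ) (ρ R : Fin N → ℝ → ℝ) (U : TopologicalSpace.Opens Literature.Geometry.Lorentzian.E4) (Ψ : (i : Fin N) → ↥(Literature.Geometry.Lorentzian.boostedKerrExterior (mot i).1 (mot i).2 (M i) (a i)) → 𝒟.carrier) (Ψ₀ : ↥U → 𝒟.carrier) (B : Set X), (∀ i, 𝒟.toSpacetime.IsLateChart (Literature.Geometry.Lorentzian.boostedKerrBackground (mot i).1 (mot i).2 (M i) (a i)) Set.univ τ₀ (Ψ i)) ∧ ContMDiff (modelWithCornersSelf ℝ Literature.Geometry.Lorentzian.E4) (modelWithCornersSelf ℝ (EuclideanSpace ℝ (Fin 4))) ((⊤ : ℕ∞) : WithTop ℕ∞) Ψ₀ ∧ Topology.IsOpenEmbedding Ψ₀ ∧ (∀ i, Filter.Tendsto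 (fun t : ℝ => ρ i t / t) Filter.atTop (nhds 0)) ∧ {x : Literature.Geometry.Lorentzian.E4 | (τ₀ < x 0 ∧ ∀ i, ρ i (x 0) < Literature.Geometry.Lorentzian.Kerr.radius (a i) (Literature.Geometry.Lorentzian.poincareInv (mot i).1 (mot i).2 x)) ∨ (-1 < x 0 ∧ ϱ₀ + |x 0| < Literature.Geometry.Lorentzian.E4.spatialNorm x)} ⊆ (U : Set Literature.Geometry.Lorentzian.E4) ∧ IsCompact B ∧ 𝒟.embed '' Bᶜ ⊆ Ψ₀ '' {x : ↥U | (-1 < x.1 0 ∧ ϱ₀ + |x.1 0| < Literature.Geometry.Lorentzian.E4.spatialNorm x.1)} ∧ (∀ i (τ : ℝ), τ₀ ≤ τ → 𝒟.toSpacetime.truncDeviationCk (Literature.Geometry.Lorentzian.boostedKerrBackground (mot i).1 (mot i).2 (M i) (a i)) (Ψ i) k (R i τ) τ ≤ ENNReal.ofReal δ) ∧ (∀ x : ↥U, (τ₀ < x.1 0 ∨ (-1 < x.1 0 ∧ ϱ₀ + |x.1 0| < Literature.Geometry.Lorentzian.E4.spatialNorm x.1)) → ∀ m : ℕ, m ≤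 k → (1 + Literature.Geometry.Lorentzian.E4.spatialNorm x.1) ^ q * (1 + |x.1 0 - Literature.Geometry.Lorentzian.E4.spatialNorm x.1|) ^ m * ‖iteratedFDeriv ℝ m (𝒟.toSpacetime.deviationExtend (Literature.Geometry.Lorentzian.Minkowski.backgroundOn U) Ψ₀) x.1‖ ≤ δ) ∧ (∀ τ₁ : ℝ, τ₀ < τ₁ → exteriorOf 𝒟.toCauchyDevelopment (Ψ₀ '' (Literature.Geometry.Lorentzian.Minkowski.backgroundOn U).lateRegion τ₀ ∪ ⋃ i, Ψ i '' (Literature.Geometry.Lorentzian.boostedKerrBackground (mot i).1 (mot i).2 (M i) (a i)).lateRegion τ₀) \ (Ψ₀ '' (Literature.Geometry.Lorentzian.Minkowski.backgroundOn U).lateRegion τ₁ ∪ ⋃ i, Ψ i '' {x | τ₁ < (Literature.Geometry.Lorentzian.boostedKerrBackground (mot i).1 (mot i).2 (M i) (a i)).time x.1 ∧ (Literature.Geometry.Lorentzian.boostedKerrBackground (mot i).1 (mot i).2 (M i) (a i)).radius x.1 ≤ R i ((Literature.Geometry.Lorentzian.boostedKerrBackground (mot i).1 (mot i).2 (M i)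 (a i)).time x.1)}) ⊆ 𝒟.metric.causalPast 𝒟.timeOrientation (Ψ₀ '' (Literature.Geometry.Lorentzian.Minkowski.backgroundOn U).timeSlab τ₁ ∪ ⋃ i, Ψ i '' (Literature.Geometry.Lorentzian.boostedKerrBackground (mot i).1 (mot i).2 (M i) (a i)).truncTimeSlab (R i τ₁) τ₁)))) 1

/-- item stmt-FinalStateConjecture-10127 · crux · rank 4 · open · by planner
why it might fail: Unweighted Cᵏ ε-closeness on slabs reaching i⁰ does not give the weighted smallness KS/GKS/DHRT start from; slowly incoming radiation and parameter drift must die by admissibility alone; constants degenerate as |a|→M and nothing nonlinear is known beyond |a|≪M.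
sources: KlainermanSzeftel2023, arXiv:2205.14808, DafermosHolzegelRodnianskiTaylor2021, DafermosRodnianskiShlapentokhrothman2014, arXiv:2302.08916, AngelopoulosAretakisGajic2018
[crux] (the Kerr-face rung in the prelude's own vocabulary) there is k such that for every
sub-extremal (M,a) there is ε>0 with: if a maximal vacuum development of admissible data REMAINS
ε-CLOSE in Cᵏ to Kerr(M,a) on a region O ⊆ J⁺(ιX) (Spacetime.RemainsCloseToKerr: late Kerr–Schild
embedding covering O, deviation ≤ ε on every slab t* = τ ≥ τ₀), then it CONVERGES on O in C² to a
nearby sub-extremal Kerr (Spacetime.ConvergesToKerr) — orbital ⇒ asymptotic stability of the Kerr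
exterior. [difficulty: open-problem] -/
@[route_item "route-FinalStateConjecture-ResolvedTimelikeInfinity", crux]
def SingleKerrOrbitalCapture : Prop :=
  ∃ (k : ℕ), ∀ (M a : ℝ), Literature.Geometry.Lorentzian.Kerr.IsSubextremal M a → ∃ ε : ℝ, 0 < ε ∧ ∀ (X : Type) [TopologicalSpace X] [ChartedSpace Literature.Geometry.Lorentzian.E3 X] [IsManifold (modelWithCornersSelf ℝ Literature.Geometry.Lorentzian.E3) ((⊤ : ℕ∞) : WithTop ℕ∞) X] [T2Space X] [SecondCountableTopology X] [ConnectedSpace X] (D : Literature.Geometry.Lorentzian.InitialDataSet (modelWithCornersSelf ℝ Literature.Geometry.Lorentzian.E3) X), D ∈ Literature.Geometry.Lorentzian.admissibleVacuumData X → ∀ 𝒟 : Literature.Geometry.Lorentzian.VacuumCauchyDevelopment D, 𝒟.IsMaximal → ∀ O : Set 𝒟.carrier, O ⊆ 𝒟.metric.causalFuture 𝒟.timeOrientation (Set.range 𝒟.embed) → 𝒟.toSpacetime.RemainsCloseToKerr O M a k (ENNReal.ofReal ε) → ∃ M' a' : ℝ, Literature.Geometry.Lorentzian.Kerr.IsSubextremal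 M' a' ∧ 𝒟.toSpacetime.ConvergesToKerr O M' a' 2

/-- item stmt-FinalStateConjecture-10128 · support · rank 9 · open · by planner
sources: Christodoulou1999
[support] Christodoulou genericity (codimension ≥ 1 inside the admissible class) is monotone in the
property: if P → Q on admissible data then generic P implies generic Q. Proved in the planner's
Sketch.lean (evidence attached); it is the only logic the deciding theorem uses. [difficulty:
provable-now] -/
@[route_item "route-FinalStateConjecture-ResolvedTimelikeInfinity", crux]
def GenericMono : Prop :=
  ∀ (X : Type) [TopologicalSpace X] [ChartedSpace Literature.Geometry.Lorentzian.E3 X] [IsManifold (modelWithCornersSelf ℝ Literature.Geometry.Lorentzian.E3) ((⊤ : ℕ∞) : WithTop ℕ∞) X] [T2Space X] [SecondCountableTopology X] [ConnectedSpace X] (P Q : Literature.Geometry.Lorentzian.InitialDataSet (modelWithCornersSelf ℝ Literature.Geometry.Lorentzian.E3) X → Prop), (∀ D ∈ Literature.Geometry.Lorentzian.admissibleVacuumData X, P D → Q D) → Literature.Geometry.Lorentzian.InitialDataSet.IsChristodoulouGeneric (Literature.Geometry.Lorentzian.admissibleVacuumData X) P 1 → Literature.Geometry.Lorentzian.InitialDataSet.IsChristodoulouGeneric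 (Literature.Geometry.Lorentzian.admissibleVacuumData X) Q 1

/-- item stmt-FinalStateConjecture-10129 · assembly · rank 1 · open · by planner
sources: arXiv:1710.01722, Christodoulou1999
[assembly] ResolvedCapture → OrbitFormation → FinalStateConjecture (proved in Sketch.lean as
`assembly_holds`). -/
@[route_item "route-FinalStateConjecture-ResolvedTimelikeInfinity", crux]
def Assembly : Prop :=
  ResolvedCapture → OrbitFormation → _root_.FinalStateConjecture

/-! D-0027 §2.1 — DECIDING THEOREM (planner-authored via `route open/edit --closes-file`; by planner-plancard-FinalStateConjecture-FinalSt-11146942-0 2026-08-15T15:12:36Z):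
its hypotheses are this route's items and its conclusion the sub-problem Statement (glue_lint), and it elaborates with this file. -/

@[closes "route-FinalStateConjecture-ResolvedTimelikeInfinity"] theorem closes : ResolvedCapture → OrbitFormation → SingleKerrOrbitalCapture → GenericMono → Assembly → _root_.FinalStateConjecture := fun h_ResolvedCapture h_OrbitFormation _h_SingleKerrOrbitalCapture _h_GenericMono _h_Assembly => by
  intro X _ _ _ _ _ _
  -- monotonicity of Christodoulou genericity in the property, inlined (it is also the support item GenericMono)
  have mono : ∀ (P Q : Literature.Geometry.Lorentzian.InitialDataSet (modelWithCornersSelf ℝ Literature.Geometry.Lorentzian.E3) X → Prop),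
      (∀ D ∈ Literature.Geometry.Lorentzian.admissibleVacuumData X, P D → Q D) →
      Literature.Geometry.Lorentzian.InitialDataSet.IsChristodoulouGeneric (Literature.Geometry.Lorentzian.admissibleVacuumData X) P 1 →
      Literature.Geometry.Lorentzian.InitialDataSet.IsChristodoulouGeneric (Literature.Geometry.Lorentzian.admissibleVacuumData X) Q 1 := by
    intro P Q hPQ hP d hd
    obtain ⟨F, hF, h0, hinj, hD, hE⟩ := hP d ⟨hd.1, fun h => hd.2 (hPQ d hd.1 h)⟩
    exact ⟨F, hF, h0, hinj, hD, fun c hc hmem => hE c hc ⟨hmem.1, fun h => hmem.2 (hPQ _ hmem.1 h)⟩⟩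
  refine mono _ _ ?_ (h_OrbitFormation X)
  rintro D hD ⟨hex, hall⟩
  refine ⟨hex, fun 𝒟 h𝒟 => ?_⟩
  obtain ⟨N, M, a, mot, hsub, hvel, horb⟩ := hall 𝒟 h𝒟
  obtain ⟨q, k, hq0, hq1, hcap⟩ := h_ResolvedCapture
  obtain ⟨δ, hδ, hcapδ⟩ := hcap N M a mot hsub hvel
  exact hcapδ X D hD 𝒟 h𝒟 (horb q k δ hq0 hq1 hδ)

end Summit.FinalStateConjecture.FinalStateConjecture.Theses.ResolvedTimelikeInfinity
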